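import Summits.BirchSwinnertonDyer.BirchSwinnertonDyer.Theorems.ResidualThetaTransportAtTwoThetaLayerLambdaCongruenceAtTwoDualChainCrossing
import Literature.NumberTheory.EllipticCurves.ModularCurveGenusIntegralityProofs
import HarnessLib

/-!
# Crux `ThetaLayerLambdaCongruenceAtTwo` (stmt-BirchSwinnertonDyer-20688, route ResidualThetaTransportAtTwo), line
# `birth` v13 — SD floor, brick S4 (part 4): the crossing vector of a dual chain of a PARABOLIC element pairs to zero with every
# closed Manin chain — cusp loops are invisible to the period lattice (width seat bsd-wall-rtt-p3-w2 g8;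
# `--supports stmt-BirchSwinnertonDyer-20688 --as helper`; closes nothing)

HONEST FRAMING. Elementary THEOREMS on lists of matrices and the coset space `SL₂(ℤ)/Γ₀(N)` (currency of `…DualChain`,
`…ManinChain`); no definition; nothing about any curve or form is asserted; BSD is not proved by any of this.

WHAT. * §1 `dualChain_T_pow_sum`: the EXPLICIT dual chain `[gT, gT², …, gTʲ]` from the triangle of `g` to that of `gTʲ` (the fan of
Farey edges at the cusp `g∞`). * §2 `dualChainVec_eq_fan_of_mul_eq`: for `γ ∈ Γ₀(N)` with `γk = ±kTʲ` (`γ` fixes the cusp `k∞`), the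
crossing vector of ANY dual chain of `γ` is that of the fan at `k` (walk to `k`, around the cusp, and back; `…DualChainCrossing`).
* §3 `fan_chainSum_eq_zero`: the fan's crossing vector pairs to `0` with every Manin chain of every `k' ∈ Γ₀(N)`: its value at the coset
of `g` is `F(g) − F(gS)` for the CUSP function `F(g) = #{i < j : (kTⁱ⁺¹)⁻¹Γ₀ = g⁻¹Γ₀}` (`T`-invariant because `T⁻ʲ` fixes `k⁻¹Γ₀(N)` —
a cyclic shift of the index), so the universal Manin-chain telescoping gives `F(k') − F(1) = 0`.
* §4 `dualChainVec_chainSum_eq_zero_of_conj_upper`: hence for EVERY `γ ∈ Γ₀(N)` fixing a cusp (`(k⁻¹γk)₁₀ = 0`; both signs of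
`±Tʲ` and both signs of `j`, via `γ⁻¹`), every dual chain `D` of `γ`, every `k' ∈ Γ₀(N)` and every Manin chain `L` of `k'`:
`Σ_{g∈L} vec(D)(g⁻¹Γ₀(N)) = 0` — i.e. `φ_{vec D} = 0` on `Λ` (`…ManinSystemFactor`). With `…DualChainCrossing` (additive, kills
elliptics) this makes `γ ↦ φ_{vec D_γ}(x)` a cusp-elliptic character for every `x ∈ Λ`, hence (by
`…ParabolicCharacterFactor.character_eq_of_periodFunctional_eq` over `ℤ`) a function of `{∞, γ∞}`: the bridge `θ : Λ → Hom(Λ, ℤ)` of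
`Cruxes/…/Lines/birth-sd2-architecture.md` is well defined (assembly: next file).

References: [Manin1972] §1.5–1.7, Thm. 1.6; J.-P. Serre, Trees, §I.4; [CremonaAlgorithms1997] §2.2.
-/

set_option autoImplicit false

noncomputable section

-- justification: the `Summit.BirchSwinnertonDyer.BirchSwinnertonDyer.…` path repeats a component (route-file convention)
set_option linter.dupNamespace false

open scoped Classical MatrixGroups

open CongruenceSubgroup Matrix.SpecialLinearGroup ModularGroup
open Literature.NumberTheory.EllipticCurves.ModularForms

namespace Summit.BirchSwinnertonDyer.BirchSwinnertonDyer.Theorems.ThetaLayerLambdaCongruenceAtTwo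

/-! ## §1. The explicit fan `[gT, …, gTʲ]` -/

section Fan

variable {N : ℕ}

/-- **The fan at a cusp is a dual chain**: `Σ_{i<j} (G(gTⁱ⁺¹) − G(gTⁱ⁺¹S)) = G(gTʲ) − G(g)` for every triangle function `G`
(`gTⁱ⁺¹S` and `gTⁱ` span the same triangle). [cite: Manin1972, Thm. 1.6] -/
theorem dualChain_T_pow_sum (g : SL(2, ℤ)) (j : ℕ) {A : Type} [AddCommGroup A] (G : SL(2, ℤ) → A)
    (hτ : ∀ x, G (x * (S * T⁻¹)) = G x) (hneg : ∀ x, G (-x) = G x) :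
    (((List.range j).map fun i ↦ g * T ^ (i + 1)).map fun h ↦ G h - G (h * S)).sum = G (g * T ^ j) - G g := by
  induction j with
  | zero => simp
  | succ j ih =>
    rw [List.range_succ, List.map_append, List.map_append, List.sum_append, ih, List.map_singleton, List.map_singleton,
      List.sum_singleton, pow_succ, ← mul_assoc, apply_mul_T_mul_S_of_triangle G hτ hneg]
    abel

/-- List sums over `List.range` are `Finset.range` sums. [folklore] -/
theorem list_sum_map_range {A : Type} [AddCommMonoid A] (j : ℕ) (f : ℕ → A) :
    ((List.range j).map f).sum = ∑ i ∈ Finset.range j, f i := by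
  induction j with
  | zero => simp
  | succ j ih => rw [List.range_succ, List.map_append, List.sum_append, ih, Finset.sum_range_succ]; simp

/-- Value of the fan's crossing vector at a coset: `F(q) − F(S·q)` with `F(q) = #{i<j : (kTⁱ⁺¹)⁻¹Γ₀(N) = q}`. [folklore] -/
theorem fanVec_apply (k : SL(2, ℤ)) (j : ℕ) (q : Gamma0Coset N) :
    (((List.range j).map fun i ↦ k * T ^ (i + 1)).map fun h ↦ (Pi.single ((h⁻¹ : SL(2, ℤ)) : Gamma0Coset N) (1 : ℤ) -
      Pi.single (((h * S)⁻¹ : SL(2, ℤ)) : Gamma0Coset N) 1 : Gamma0Coset N → ℤ)).sum q =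
    (∑ i ∈ Finset.range j, (if (((k * T ^ (i + 1))⁻¹ : SL(2, ℤ)) : Gamma0Coset N) = q then (1 : ℤ) else 0)) -
    (∑ i ∈ Finset.range j, (if (((k * T ^ (i + 1))⁻¹ : SL(2, ℤ)) : Gamma0Coset N) = S • q then (1 : ℤ) else 0)) := by
  rw [dualChainVec_apply, List.map_map, ← Finset.sum_sub_distrib, ← list_sum_map_range]
  congr 1
  refine List.map_congr_left fun i _ ↦ ?_
  have hSS : ∀ q : Gamma0Coset N, S • S • q = q := fun q ↦ by
    rw [← mul_smul, S_mul_S_eq_neg_one, neg_one_smul_coset]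
  have e : ((((k * T ^ (i + 1) * S)⁻¹ : SL(2, ℤ)) : Gamma0Coset N) = q) ↔
      ((((k * T ^ (i + 1))⁻¹ : SL(2, ℤ)) : Gamma0Coset N) = S • q) := by
    rw [coe_mul_S_inv]
    constructor
    · intro h; rw [← h, hSS]
    · intro h; rw [h, hSS]
  simp only [Function.comp_apply, e]

/-- **The fan pairs to zero with every closed Manin chain.** If `T⁻ʲ` fixes the coset `k⁻¹Γ₀(N)` (`(kTʲ)⁻¹Γ₀ = k⁻¹Γ₀`, which holds
when `±kTʲk⁻¹ ∈ Γ₀(N)`), then for every `k' ∈ Γ₀(N)` and every Manin chain `L` of `k'` (universal chain of `…ManinChain`):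
`Σ_{g∈L} fanVec(g⁻¹Γ₀(N)) = 0`. The counting function `F` is a cusp function (cyclic shift), and the Manin chain telescopes it to
`F(k') − F(1) = 0`. [cite: Manin1972, Thm. 1.6] -/
theorem fan_chainSum_eq_zero (k : SL(2, ℤ)) (j : ℕ)
    (hfix : (((k * T ^ j)⁻¹ : SL(2, ℤ)) : Gamma0Coset N) = ((k⁻¹ : SL(2, ℤ)) : Gamma0Coset N))
    (k' : Gamma0 N) (L : List SL(2, ℤ))
    (hL : ∀ {A : Type} [AddCommGroup A] (F : SL(2, ℤ) → A), (∀ g, F (g * T) = F g) → (∀ g, F (-g) = F g) →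
      (L.map fun g ↦ F g - F (g * S)).sum = F (k' : SL(2, ℤ)) - F 1) :
    (L.map fun g ↦ (((List.range j).map fun i ↦ k * T ^ (i + 1)).map fun h ↦
      (Pi.single ((h⁻¹ : SL(2, ℤ)) : Gamma0Coset N) (1 : ℤ) - Pi.single (((h * S)⁻¹ : SL(2, ℤ)) : Gamma0Coset N) 1 :
        Gamma0Coset N → ℤ)).sum ((g⁻¹ : SL(2, ℤ)) : Gamma0Coset N)).sum = 0 := by
  -- the counting function
  let F : SL(2, ℤ) → ℤ := fun g ↦
    ∑ i ∈ Finset.range j, (if (((k * T ^ (i + 1))⁻¹ : SL(2, ℤ)) : Gamma0Coset N) = ((g⁻¹ : SL(2, ℤ)) : Gamma0Coset N)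
      then (1 : ℤ) else 0)
  have hF : ∀ g, F g = ∑ i ∈ Finset.range j, (if (((k * T ^ (i + 1))⁻¹ : SL(2, ℤ)) : Gamma0Coset N) =
      ((g⁻¹ : SL(2, ℤ)) : Gamma0Coset N) then (1 : ℤ) else 0) := fun g ↦ rfl
  -- `T`-invariance by the cyclic shift
  have hT : ∀ g, F (g * T) = F g := by
    intro g
    rw [hF, hF]
    -- `(kT^{i+1})⁻¹Γ₀ = (gT)⁻¹Γ₀ ↔ (kT^i)⁻¹Γ₀ = g⁻¹Γ₀`
    have step : ∀ i : ℕ, ((((k * T ^ (i + 1))⁻¹ : SL(2, ℤ)) : Gamma0Coset N) = (((g * T)⁻¹ : SL(2, ℤ)) : Gamma0Coset N)) ↔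
        ((((k * T ^ i)⁻¹ : SL(2, ℤ)) : Gamma0Coset N) = ((g⁻¹ : SL(2, ℤ)) : Gamma0Coset N)) := by
      intro i
      have e1 : (((k * T ^ (i + 1))⁻¹ : SL(2, ℤ)) : Gamma0Coset N) = T⁻¹ • (((k * T ^ i)⁻¹ : SL(2, ℤ)) : Gamma0Coset N) := by
        rw [pow_succ, ← mul_assoc, mul_inv_rev, MulAction.Quotient.smul_mk, smul_eq_mul]
      have e2 : (((g * T)⁻¹ : SL(2, ℤ)) : Gamma0Coset N) = T⁻¹ • ((g⁻¹ : SL(2, ℤ)) : Gamma0Coset N) := by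
        rw [mul_inv_rev, MulAction.Quotient.smul_mk, smul_eq_mul]
      rw [e1, e2, smul_left_cancel_iff]
    simp only [step]
    -- shift: `Σ_{i<j} f i = Σ_{i<j} f (i+1)` because `f 0 = f j` (periodicity `hfix`)
    have hper : (if (((k * T ^ 0)⁻¹ : SL(2, ℤ)) : Gamma0Coset N) = ((g⁻¹ : SL(2, ℤ)) : Gamma0Coset N) then (1 : ℤ) else 0) =
        (if (((k * T ^ j)⁻¹ : SL(2, ℤ)) : Gamma0Coset N) = ((g⁻¹ : SL(2, ℤ)) : Gamma0Coset N) then (1 : ℤ) else 0) := by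
      rw [pow_zero, mul_one, hfix]
    have key := Finset.sum_range_succ' (fun i ↦ (if (((k * T ^ i)⁻¹ : SL(2, ℤ)) : Gamma0Coset N) =
      ((g⁻¹ : SL(2, ℤ)) : Gamma0Coset N) then (1 : ℤ) else 0)) j
    rw [Finset.sum_range_succ, hper] at key
    -- key : Σ_{i<j} f i + f j = Σ_{i<j} f (i+1) + f j
    exact add_right_cancel key
  have hn : ∀ g, F (-g) = F g := by
    intro g
    rw [hF, hF]
    have : (((-g)⁻¹ : SL(2, ℤ)) : Gamma0Coset N) = ((g⁻¹ : SL(2, ℤ)) : Gamma0Coset N) := by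
      rw [QuotientGroup.eq, inv_inv, neg_mul, mul_inv_cancel]
      simp [Gamma0_mem]
    rw [this]
  -- the chain sum is the telescoping sum of `F`
  have e : (L.map fun g ↦ (((List.range j).map fun i ↦ k * T ^ (i + 1)).map fun h ↦
      (Pi.single ((h⁻¹ : SL(2, ℤ)) : Gamma0Coset N) (1 : ℤ) - Pi.single (((h * S)⁻¹ : SL(2, ℤ)) : Gamma0Coset N) 1 :
        Gamma0Coset N → ℤ)).sum ((g⁻¹ : SL(2, ℤ)) : Gamma0Coset N)) = L.map fun g ↦ F g - F (g * S) := by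
    refine List.map_congr_left fun g _ ↦ ?_
    rw [fanVec_apply, hF, hF, coe_mul_S_inv]
  rw [e, hL F hT hn, hF, hF]
  have : ((((k' : SL(2, ℤ)))⁻¹ : SL(2, ℤ)) : Gamma0Coset N) = (((1 : SL(2, ℤ))⁻¹ : SL(2, ℤ)) : Gamma0Coset N) := by
    rw [inv_one, QuotientGroup.eq]
    simp
  rw [this, sub_self]

end Fan

/-! ## §2. The crossing vector of a dual chain of a cusp-fixing element is a fan -/

section Parabolic

variable {N : ℕ}

/-- **Walk to `k`, around the cusp `k∞`, and back**: if `γk = kTʲ` or `γk = −kTʲ` (`γ ∈ Γ₀(N)`, `j ∈ ℕ`), the crossing vector of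
every dual chain `D` of `γ` equals that of the fan `[kT, …, kTʲ]` (chain independence, `Γ₀(N)`-invariance and reversal from
`…DualChainCrossing`). [cite: Manin1972, §1.5] -/
theorem dualChainVec_eq_fan_of_mul_eq (γ : Gamma0 N) (k : SL(2, ℤ)) (j : ℕ)
    (hγ : (γ : SL(2, ℤ)) * k = k * T ^ j ∨ (γ : SL(2, ℤ)) * k = -(k * T ^ j)) (D : List SL(2, ℤ))
    (hD : ∀ {A : Type} [AddCommGroup A] (G : SL(2, ℤ) → A),
      (∀ x, G (x * (S * T⁻¹)) = G x) → (∀ x, G (-x) = G x) → (D.map fun h ↦ G h - G (h * S)).sum = G (γ : SL(2, ℤ)) - G 1)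
    (q : Gamma0Coset N) :
    (D.map fun h ↦ (Pi.single ((h⁻¹ : SL(2, ℤ)) : Gamma0Coset N) (1 : ℤ) -
      Pi.single (((h * S)⁻¹ : SL(2, ℤ)) : Gamma0Coset N) 1 : Gamma0Coset N → ℤ)).sum q =
    (((List.range j).map fun i ↦ k * T ^ (i + 1)).map fun h ↦ (Pi.single ((h⁻¹ : SL(2, ℤ)) : Gamma0Coset N) (1 : ℤ) -
      Pi.single (((h * S)⁻¹ : SL(2, ℤ)) : Gamma0Coset N) 1 : Gamma0Coset N → ℤ)).sum q := by
  obtain ⟨Dk, hDk⟩ := exists_dualChain k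
  have hGγk : ∀ {A : Type} (G : SL(2, ℤ) → A), (∀ x, G (-x) = G x) → G ((γ : SL(2, ℤ)) * k) = G (k * T ^ j) := by
    intro A G hn
    rcases hγ with h | h
    · rw [h]
    · rw [h, hn]
  have hE : ∀ {A : Type} [AddCommGroup A] (G : SL(2, ℤ) → A), (∀ x, G (x * (S * T⁻¹)) = G x) → (∀ x, G (-x) = G x) →
      ((Dk ++ ((List.range j).map fun i ↦ k * T ^ (i + 1)) ++ (Dk.map fun h ↦ h * S).map fun h ↦ (γ : SL(2, ℤ)) * h).map
        fun h ↦ G h - G (h * S)).sum = G (γ : SL(2, ℤ)) - G 1 := by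
    intro A _ G hτ hn
    rw [List.map_append, List.map_append, List.sum_append, List.sum_append, hDk G hτ hn, dualChain_T_pow_sum k j G hτ hn,
      List.map_map, List.map_map]
    have h2 := hDk (fun g ↦ G ((γ : SL(2, ℤ)) * g)) (fun g ↦ by rw [← mul_assoc, hτ]) (fun g ↦ by simp only [mul_neg, hn])
    have e : (Dk.map (((fun h ↦ G h - G (h * S)) ∘ fun h ↦ (γ : SL(2, ℤ)) * h) ∘ fun h ↦ h * S)).sum =
        -(Dk.map fun g ↦ G ((γ : SL(2, ℤ)) * g) - G ((γ : SL(2, ℤ)) * (g * S))).sum := by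
      rw [List.sum_neg, List.map_map]
      congr 1
      refine List.map_congr_left fun g _ ↦ ?_
      have e3 : (γ : SL(2, ℤ)) * (g * S) * S = -((γ : SL(2, ℤ)) * g) := by
        rw [mul_assoc, mul_assoc g, S_mul_S_eq_neg_one, mul_neg_one, mul_neg]
      simp only [Function.comp_apply]
      rw [e3, hn, neg_sub]
    rw [e, h2, mul_one, hGγk G hn]
    abel
  rw [dualChainVec_eq_of_dualChain _ D _ hD hE q, List.map_append, List.map_append, List.sum_append, List.sum_append,
    Pi.add_apply, Pi.add_apply, dualChainVec_map_mul_left, dualChainVec_map_mul_S]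
  abel

/-- The coset `k⁻¹Γ₀(N)` is fixed by `T⁻ʲ` when `γk = ±kTʲ` with `γ ∈ Γ₀(N)`. [folklore] -/
theorem coe_mul_T_pow_inv_of_mul_eq (γ : Gamma0 N) (k : SL(2, ℤ)) (j : ℕ)
    (hγ : (γ : SL(2, ℤ)) * k = k * T ^ j ∨ (γ : SL(2, ℤ)) * k = -(k * T ^ j)) :
    (((k * T ^ j)⁻¹ : SL(2, ℤ)) : Gamma0Coset N) = ((k⁻¹ : SL(2, ℤ)) : Gamma0Coset N) := by
  rw [QuotientGroup.eq, inv_inv]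
  rcases hγ with h | h
  · rw [← h, mul_inv_cancel_right]; exact γ.2
  · have h' : k * T ^ j = -((γ : SL(2, ℤ)) * k) := by rw [h, neg_neg]
    rw [h', neg_mul, mul_inv_cancel_right, neg_eq_neg_one_mul]
    exact (Gamma0 N).mul_mem (by simp [Gamma0_mem]) γ.2

/-- **Cusp-fixing elements pair to zero** (natural-power case): if `γk = ±kTʲ` then for every dual chain `D` of `γ`, every
`k' ∈ Γ₀(N)` and every Manin chain `L` of `k'`: `Σ_{g∈L} vec(D)(g⁻¹Γ₀(N)) = 0`. [cite: Manin1972, Thm. 1.6] -/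
theorem dualChainVec_chainSum_eq_zero_of_mul_eq (γ : Gamma0 N) (k : SL(2, ℤ)) (j : ℕ)
    (hγ : (γ : SL(2, ℤ)) * k = k * T ^ j ∨ (γ : SL(2, ℤ)) * k = -(k * T ^ j)) (D : List SL(2, ℤ))
    (hD : ∀ {A : Type} [AddCommGroup A] (G : SL(2, ℤ) → A),
      (∀ x, G (x * (S * T⁻¹)) = G x) → (∀ x, G (-x) = G x) → (D.map fun h ↦ G h - G (h * S)).sum = G (γ : SL(2, ℤ)) - G 1)
    (k' : Gamma0 N) (L : List SL(2, ℤ))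
    (hL : ∀ {A : Type} [AddCommGroup A] (F : SL(2, ℤ) → A), (∀ g, F (g * T) = F g) → (∀ g, F (-g) = F g) →
      (L.map fun g ↦ F g - F (g * S)).sum = F (k' : SL(2, ℤ)) - F 1) :
    (L.map fun g ↦ (D.map fun h ↦ (Pi.single ((h⁻¹ : SL(2, ℤ)) : Gamma0Coset N) (1 : ℤ) -
      Pi.single (((h * S)⁻¹ : SL(2, ℤ)) : Gamma0Coset N) 1 : Gamma0Coset N → ℤ)).sum ((g⁻¹ : SL(2, ℤ)) : Gamma0Coset N)).sum = 0 := by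
  have e : (L.map fun g ↦ (D.map fun h ↦ (Pi.single ((h⁻¹ : SL(2, ℤ)) : Gamma0Coset N) (1 : ℤ) -
      Pi.single (((h * S)⁻¹ : SL(2, ℤ)) : Gamma0Coset N) 1 : Gamma0Coset N → ℤ)).sum ((g⁻¹ : SL(2, ℤ)) : Gamma0Coset N)) =
      L.map fun g ↦ (((List.range j).map fun i ↦ k * T ^ (i + 1)).map fun h ↦
        (Pi.single ((h⁻¹ : SL(2, ℤ)) : Gamma0Coset N) (1 : ℤ) - Pi.single (((h * S)⁻¹ : SL(2, ℤ)) : Gamma0Coset N) 1 :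
          Gamma0Coset N → ℤ)).sum ((g⁻¹ : SL(2, ℤ)) : Gamma0Coset N) :=
    List.map_congr_left fun g _ ↦ dualChainVec_eq_fan_of_mul_eq γ k j hγ D hD _
  rw [e]
  exact fan_chainSum_eq_zero k j (coe_mul_T_pow_inv_of_mul_eq γ k j hγ) k' L hL

/-- **Cusp-fixing elements pair to zero with every closed Manin chain.** If `γ ∈ Γ₀(N)` fixes a cusp — `(k⁻¹γk)₁₀ = 0` for some
`k ∈ SL₂(ℤ)`, so `k⁻¹γk = ±Tᶻ` (`exists_eq_T_zpow_or_of_apply_one_zero`) — then for every dual chain `D` of `γ`, every `k' ∈ Γ₀(N)`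
and every Manin chain `L` of `k'`: `Σ_{g∈L} vec(D)(g⁻¹Γ₀(N)) = 0`. (For `z < 0` pass to `γ⁻¹`, whose dual chains have the opposite
vector by `dualChainVec_mul`.) Hence `φ_{vec D} = 0` on the period lattice. [cite: Manin1972, Thm. 1.6] -/
theorem dualChainVec_chainSum_eq_zero_of_conj_upper (γ : Gamma0 N) (k : SL(2, ℤ))
    (hup : (k⁻¹ * (γ : SL(2, ℤ)) * k) 1 0 = 0) (D : List SL(2, ℤ))
    (hD : ∀ {A : Type} [AddCommGroup A] (G : SL(2, ℤ) → A),
      (∀ x, G (x * (S * T⁻¹)) = G x) → (∀ x, G (-x) = G x) → (D.map fun h ↦ G h - G (h * S)).sum = G (γ : SL(2, ℤ)) - G 1)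
    (k' : Gamma0 N) (L : List SL(2, ℤ))
    (hL : ∀ {A : Type} [AddCommGroup A] (F : SL(2, ℤ) → A), (∀ g, F (g * T) = F g) → (∀ g, F (-g) = F g) →
      (L.map fun g ↦ F g - F (g * S)).sum = F (k' : SL(2, ℤ)) - F 1) :
    (L.map fun g ↦ (D.map fun h ↦ (Pi.single ((h⁻¹ : SL(2, ℤ)) : Gamma0Coset N) (1 : ℤ) -
      Pi.single (((h * S)⁻¹ : SL(2, ℤ)) : Gamma0Coset N) 1 : Gamma0Coset N → ℤ)).sum ((g⁻¹ : SL(2, ℤ)) : Gamma0Coset N)).sum = 0 := by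
  obtain ⟨z, hz⟩ := exists_eq_T_zpow_or_of_apply_one_zero hup
  -- `γ k = k (±T^z)`
  have hγk : (γ : SL(2, ℤ)) * k = k * T ^ z ∨ (γ : SL(2, ℤ)) * k = -(k * T ^ z) := by
    rcases hz with h | h
    · left; rw [← h]; group
    · right; rw [show k * T ^ z = -(k * (k⁻¹ * (γ : SL(2, ℤ)) * k)) by rw [h]; simp, neg_neg]; group
  rcases Int.eq_nat_or_neg z with ⟨j, rfl | rfl⟩
  · -- `z = j ≥ 0`
    rw [zpow_natCast] at hγk
    exact dualChainVec_chainSum_eq_zero_of_mul_eq γ k j hγk D hD k' L hL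
  · -- `z = -j`: use `γ⁻¹`, `γ⁻¹ k = ± k T^j`
    have hγk' : ((γ⁻¹ : Gamma0 N) : SL(2, ℤ)) * k = k * T ^ j ∨ ((γ⁻¹ : Gamma0 N) : SL(2, ℤ)) * k = -(k * T ^ j) := by
      rw [InvMemClass.coe_inv]
      rcases hγk with h | h
      · left
        rw [inv_mul_eq_iff_eq_mul, ← mul_assoc, h, mul_assoc, ← zpow_natCast, ← zpow_add, neg_add_cancel, zpow_zero, mul_one]
      · right
        rw [inv_mul_eq_iff_eq_mul, mul_neg, ← mul_assoc, h, neg_mul, neg_neg, mul_assoc, ← zpow_natCast, ← zpow_add,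
          neg_add_cancel, zpow_zero, mul_one]
    obtain ⟨D', hD'⟩ := exists_dualChain ((γ⁻¹ : Gamma0 N) : SL(2, ℤ))
    obtain ⟨D₁, hD₁⟩ := exists_dualChain ((γ * γ⁻¹ : Gamma0 N) : SL(2, ℤ))
    -- `vec D₁ = 0` (closed) and `vec D₁ = vec D + vec D'`
    have hcl : ∀ {A : Type} [AddCommGroup A] (G : SL(2, ℤ) → A), (∀ x, G (x * (S * T⁻¹)) = G x) → (∀ x, G (-x) = G x) →
        (D₁.map fun h ↦ G h - G (h * S)).sum = 0 := fun G hτ hn ↦ by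
      rw [hD₁ G hτ hn, mul_inv_cancel, OneMemClass.coe_one, sub_self]
    have hadd := fun q ↦ dualChainVec_mul γ γ⁻¹ D D' D₁ hD hD' hD₁ q
    have hvec : ∀ q : Gamma0Coset N, (D.map fun h ↦ (Pi.single ((h⁻¹ : SL(2, ℤ)) : Gamma0Coset N) (1 : ℤ) -
        Pi.single (((h * S)⁻¹ : SL(2, ℤ)) : Gamma0Coset N) 1 : Gamma0Coset N → ℤ)).sum q =
        -(D'.map fun h ↦ (Pi.single ((h⁻¹ : SL(2, ℤ)) : Gamma0Coset N) (1 : ℤ) -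
          Pi.single (((h * S)⁻¹ : SL(2, ℤ)) : Gamma0Coset N) 1 : Gamma0Coset N → ℤ)).sum q := fun q ↦ by
      have h0 := dualChainVec_eq_zero_of_closed (N := N) D₁ hcl q
      rw [hadd q] at h0
      omega
    have h' := dualChainVec_chainSum_eq_zero_of_mul_eq γ⁻¹ k j hγk' D' hD' k' L hL
    have e : (L.map fun g ↦ (D.map fun h ↦ (Pi.single ((h⁻¹ : SL(2, ℤ)) : Gamma0Coset N) (1 : ℤ) -
        Pi.single (((h * S)⁻¹ : SL(2, ℤ)) : Gamma0Coset N) 1 : Gamma0Coset N → ℤ)).sum ((g⁻¹ : SL(2, ℤ)) : Gamma0Coset N)) =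
        L.map fun g ↦ -((D'.map fun h ↦ (Pi.single ((h⁻¹ : SL(2, ℤ)) : Gamma0Coset N) (1 : ℤ) -
          Pi.single (((h * S)⁻¹ : SL(2, ℤ)) : Gamma0Coset N) 1 : Gamma0Coset N → ℤ)).sum ((g⁻¹ : SL(2, ℤ)) : Gamma0Coset N)) :=
      List.map_congr_left fun g _ ↦ hvec _
    rw [e]
    have hs : (L.map fun g ↦ -((D'.map fun h ↦ (Pi.single ((h⁻¹ : SL(2, ℤ)) : Gamma0Coset N) (1 : ℤ) -
        Pi.single (((h * S)⁻¹ : SL(2, ℤ)) : Gamma0Coset N) 1 : Gamma0Coset N → ℤ)).sum ((g⁻¹ : SL(2, ℤ)) : Gamma0Coset N))).sum =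
        -((L.map fun g ↦ (D'.map fun h ↦ (Pi.single ((h⁻¹ : SL(2, ℤ)) : Gamma0Coset N) (1 : ℤ) -
          Pi.single (((h * S)⁻¹ : SL(2, ℤ)) : Gamma0Coset N) 1 : Gamma0Coset N → ℤ)).sum ((g⁻¹ : SL(2, ℤ)) : Gamma0Coset N)).sum) := by
      rw [List.sum_neg, List.map_map]
      rfl
    rw [hs, h', neg_zero]

end Parabolic

end Summit.BirchSwinnertonDyer.BirchSwinnertonDyer.Theorems.ThetaLayerLambdaCongruenceAtTwo

end
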